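import Literature.MathematicalPhysics.QuantumFieldTheory.QCDTransferMatrix

/-!
# The one-step matrix `−ẼF` is Lüscher's positive core dressed by the temporal transporters
(helper for crux stmt-QuantumFields-9737 `QuarksAsStableAction.StableActionBridge`, line `Sketch`;
stub `neg_explicitInv_mul_eq_dressed`)

In the time-slice reduction of the Wilson fermion determinant the chain blocks are
`E = (Bh + C) P⁻ − P⁺ W′` and `F = (Bh + C) P⁺ − P⁻ W`, where `P± = ½(1 ± γ₀)` are complementary
projections (`Pp`, `Pm` below: idempotent, mutually annihilating), `Bh` is the spin-blind slice operator
(commuting with `P±`, invertible), `C` is the spin-off-diagonal hopping part (`P⁺ C P⁺ = 0`) and `W` is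
the temporal transporter (commuting with `P±`).  With the explicit inverse
`Ẽ = −W P⁺ + W P⁺ C Bh⁻¹ P⁻ + Bh⁻¹ P⁻` of `E`, the one-step matrix `−Ẽ F` equals the positive core
`M′ = (1 + P⁺ C P⁻)(Bh P⁺ + Bh⁻¹ P⁻)(1 − P⁻ C P⁺)` dressed by the transporters:
`−Ẽ F = (W P⁺ + P⁻) · M′ · (P⁺ + W P⁻)`.

The proof is pure matrix algebra: both sides expand (after killing the monomials containing
`P⁺P⁻`, `P⁻P⁺`, `P⁺ C P⁺` and merging repeated projections) to the same five monomials
`W Bh P⁺ − W P⁺ C Bh⁻¹ P⁻ C P⁺ + W P⁺ C Bh⁻¹ P⁻ W − Bh⁻¹ P⁻ C P⁺ + Bh⁻¹ P⁻ W`.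
The hypotheses `Pp + Pm = 1` and `Pm * C * Pm = 0` of the registered signature are not needed.
Pure theorem file (no definitions).
-/

namespace Summit.QuantumFields.QCD.Cruxes.StableActionBridge.Sketch

open scoped ComplexOrder
open Literature.MathematicalPhysics.QuantumFieldTheory Literature.MathematicalPhysics.QuantumLattice

namespace DressedTransfer

variable {n : Type*} [Fintype n]

/-- If `B` is invertible and commutes with `P`, then so does `B⁻¹` (nonsingular inverse). -/
theorem nonsing_inv_mul_comm [DecidableEq n] {B P : Matrix n n ℂ} (hB : IsUnit B.det)
    (h : B * P = P * B) : B⁻¹ * P = P * B⁻¹ :=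
  calc B⁻¹ * P = B⁻¹ * P * B * B⁻¹ := (Matrix.mul_nonsing_inv_cancel_right B (B⁻¹ * P) hB).symm
    _ = B⁻¹ * (B * P) * B⁻¹ := by rw [h, Matrix.mul_assoc B⁻¹ P B]
    _ = P * B⁻¹ := by rw [Matrix.nonsing_inv_mul_cancel_left B P hB]

/-- Right-associated form of a product relation: `A * B = C` gives `A * (B * X) = C * X`. -/
theorem mul_mul_eq {A B C : Matrix n n ℂ} (h : A * B = C) (X : Matrix n n ℂ) :
    A * (B * X) = C * X := by
  rw [← Matrix.mul_assoc, h]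

/-- Right-associated form of a commutation relation: `A * B = B * A` gives
`A * (B * X) = B * (A * X)`. -/
theorem mul_mul_comm {A B : Matrix n n ℂ} (h : A * B = B * A) (X : Matrix n n ℂ) :
    A * (B * X) = B * (A * X) := by
  rw [← Matrix.mul_assoc, h, Matrix.mul_assoc]

end DressedTransfer

/-- **Dressed form of the one-step matrix** (stub `neg_explicitInv_mul_eq_dressed` of line `Sketch`):
for mutually annihilating idempotents `Pp`, `Pm`, an invertible `Bh` commuting with both, a hopping
part `C` with `Pp * C * Pp = 0` and a transporter `W` commuting with `Pp`, `Pm`, the one-step matrix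
`−Ẽ F` with `Ẽ = −W Pp + W Pp C Bh⁻¹ Pm + Bh⁻¹ Pm`, `F = (Bh + C) Pp − Pm W` equals the positive core
`(1 + Pp C Pm)(Bh Pp + Bh⁻¹ Pm)(1 − Pm C Pp)` dressed by `W Pp + Pm` on the left and `Pp + W Pm` on
the right.  (The hypotheses `Pp + Pm = 1` and `Pm * C * Pm = 0` are not used.) -/
theorem neg_explicitInv_mul_eq_dressed :
    ∀ (n : Type) [Fintype n] [DecidableEq n] (Pp Pm Bh C W : Matrix n n ℂ),
      Pp + Pm = 1 → Pp * Pp = Pp → Pm * Pm = Pm → Pp * Pm = 0 → Pm * Pp = 0 →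
      Bh * Pp = Pp * Bh → Bh * Pm = Pm * Bh → Pp * C * Pp = 0 → Pm * C * Pm = 0 →
      W * Pp = Pp * W → W * Pm = Pm * W → IsUnit Bh.det →
      -((-(W * Pp) + W * Pp * C * Bh⁻¹ * Pm + Bh⁻¹ * Pm) * ((Bh + C) * Pp - Pm * W)) =
        (W * Pp + Pm) * ((1 + Pp * C * Pm) * (Bh * Pp + Bh⁻¹ * Pm) * (1 - Pm * C * Pp)) * (Pp + W * Pm) := by
  intro n _ _ Pp Pm Bh C W _ hPP hQQ hPQ hQP hBP hBQ hPCP _ hWP hWQ hBh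
  -- `Bh⁻¹` commutes with `Pm` (its commutation with `Pp` is not needed below)
  have hIQ : Bh⁻¹ * Pm = Pm * Bh⁻¹ := DressedTransfer.nonsing_inv_mul_comm hBh hBQ
  -- tail form of the vanishing triple product
  have hPCP' : Pp * (C * Pp) = 0 := by rw [← Matrix.mul_assoc, hPCP]
  -- step 1: distribute into right-associated monomials (original letter order)
  simp only [Matrix.mul_add, Matrix.add_mul, Matrix.mul_sub, Matrix.sub_mul, neg_mul,
    Matrix.one_mul, Matrix.mul_one, Matrix.mul_assoc, neg_sub]
  -- step 2: normalise each monomial from the right (projections move left through `Bh`,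
  -- `Bh⁻¹`, `W`; repeated projections merge; `Pp Pm = Pm Pp = Pp C Pp = 0` kill)
  simp only [hPP, hQP, hBP, hWQ, hPCP', DressedTransfer.mul_mul_eq hPP,
    DressedTransfer.mul_mul_eq hQQ, DressedTransfer.mul_mul_eq hPQ, DressedTransfer.mul_mul_eq hQP,
    DressedTransfer.mul_mul_comm hIQ, DressedTransfer.mul_mul_comm hWP,
    Matrix.mul_zero, Matrix.zero_mul, neg_zero, add_zero, zero_add, sub_zero]
  abel

end Summit.QuantumFields.QCD.Cruxes.StableActionBridge.Sketch
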